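import Summits.CriticalPhenomena.PercolationContinuityZ3.Theorems.PercNearOneGluingNoHeavyLowerTailThreeSumCells
import HarnessLib

/-!
# `NoHeavyLowerTail` (stmt-CriticalPhenomena-4575) — the 3-sum theorem for R1, measure level, part 9:
# the CLAW piece (`a, b, c` hung on one vertex) satisfies R1, LB, LG for every `φ_{𝐩,q}`, `q > 0`

Support file (prover prim-gen-kcluster gen 71; `--supports stmt-CriticalPhenomena-4575`).  No definitions, no
named facts, no sorries.

The smallest non-trivial `{a,b,c}`-bridge is the claw `K_{1,3}`: a vertex `v` joined to `a`, `b`, `c` by pairs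
`e₁ = s(v,a)`, `e₂ = s(v,b)`, `e₃ = s(v,c)` with arbitrary parameters.  For the free random-cluster measure
`φ = rcMeasureW u q ∅` with `u` supported on `{e₁, e₂, e₃}` (any `q > 0`) the three rows of part 6 hold
(R1 and the two companions with equality-type slack coming from the leaf structure):
* `ThreeSum.claw_r1` — `φ(T)·φ(S) ≤ φ(U_b)·φ(U_c)`;
* `ThreeSum.claw_lb` — `φ(S)·φ(U_a) ≤ φ(N)·φ(U_b)`;  `ThreeSum.claw_lg` — `φ(S)·φ(U_a) ≤ φ(N)·φ(U_c)`.
PROOF (no cell computation): on the support the cells are cylinder events of the three pairs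
(`claw_cells`: `abc = {e₁,e₂,e₃ open}`, `S = {e₁ open, e₂, e₃ closed}`, …); the involution of PAIRS of
configurations that exchanges the `e₃`-coordinates (resp. `e₂`) maps `T × S` into `U_b × U_c` (resp.
`S × U_a` into `U_b × N`, `U_c × N`) preserving the product of the two random-cluster weights (product part:
`BHK2006.weight_swap`; cluster part: opening a pair towards an isolated leaf lowers the count by exactly one on
either side), so the product of masses is dominated term by term (`Fintype.sum_bijective`).
With parts 6–8 (closure of (R1, LB, LG) under 3-sums) this gives R1-RC on `K_{3,n}` and on every graph glued
from claws and R1-pieces along `{a,b,c}` (part 10).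
-/

noncomputable section

namespace Summit.CriticalPhenomena.PercolationContinuityZ3.Theorems

namespace ThreeSum

open Finset SimpleGraph Literature.Probability.Percolation Literature.Probability.Percolation.Gladkov
open Literature.Probability.Percolation.BHK2006 (weight weight_swap swap_involutive)
open Literature.Probability.Percolation.DecisionTree (ind ind_of_mem ind_of_not_mem ind_nonneg)
open Literature.Probability.LatticeModels RefinedRowR3 ThreePointLB MeasureTheory
open scoped Classical

variable {V : Type*} [Fintype V]

/-! ### The claw: cells as cylinder events -/

section Claw

variable {a b c v : V} {D : Finset (Sym2 V)}

omit [Fintype V] in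
/-- Two vertices joined by open pairs through `v`. [folklore] -/
theorem claw_reach [Fintype V] {ω : BondConfig V} {x y : V} (hx : s(v, x) ∈ ω) (hy : s(v, y) ∈ ω) (hvx : v ≠ x)
    (hvy : v ≠ y) : y ∈ cl ω.toFinset x := by
  rw [mem_cl, Set.coe_toFinset]
  have h1 : (openGraph ω).Adj x v := by
    rw [openGraph_adj, Sym2.eq_swap]; exact ⟨hx, hvx.symm⟩
  have h2 : (openGraph ω).Adj v y := by
    rw [openGraph_adj]; exact ⟨hy, hvy⟩
  exact h1.reachable.trans h2.reachable

/-- A connection between two vertices whose only support pairs are `s(v,x)`, `s(v,y)` uses both pairs. [this work] -/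
theorem claw_mem_cl {ω : BondConfig V} (hω : ω ⊆ ↑D) {x y : V} (hxy : x ≠ y) (h : y ∈ cl ω.toFinset x)
    (hx : ∀ e ∈ D, x ∈ e → e = s(v, x)) (hy : ∀ e ∈ D, y ∈ e → e = s(v, y)) :
    s(v, x) ∈ ω ∧ s(v, y) ∈ ω := by
  constructor
  · obtain ⟨e, he, hxe⟩ := APL.exists_mem_edge_of_mem_cl (mem_cl_comm.1 h) hxy
    rw [mem_toFinset'] at he
    rwa [← hx e (hω he) hxe]
  · obtain ⟨e, he, hye⟩ := APL.exists_mem_edge_of_mem_cl h hxy.symm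
    rw [mem_toFinset'] at he
    rwa [← hy e (hω he) hye]

variable (hab : a ≠ b) (hac : a ≠ c) (hbc : b ≠ c) (hva : v ≠ a) (hvb : v ≠ b) (hvc : v ≠ c)
  (hD : ∀ e, e ∈ D ↔ (e = s(v, a) ∨ e = s(v, b) ∨ e = s(v, c)))
include hab hac hbc hva hvb hvc hD

omit [Fintype V] in
/-- On the claw support, the pairs at `a`, `b`, `c` are `e₁`, `e₂`, `e₃` respectively. [folklore] -/
theorem claw_pairs {e : Sym2 V} (he : e ∈ D) :
    (a ∈ e → e = s(v, a)) ∧ (b ∈ e → e = s(v, b)) ∧ (c ∈ e → e = s(v, c)) := by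
  rcases (hD e).1 he with rfl | rfl | rfl <;>
    simp only [Sym2.mem_iff] <;>
    refine ⟨fun h => ?_, fun h => ?_, fun h => ?_⟩ <;>
    first | rfl | (rcases h with h | h <;> simp_all)

/-- **The claw cells are cylinder events** (configurations inside the support): `b ∈ C(a) ↔ e₁, e₂ open`,
`c ∈ C(a) ↔ e₁, e₃ open`, `c ∈ C(b) ↔ e₂, e₃ open`, and `C(a)` meets the only `b–c` support path `b v c` iff
`e₁` is open. [this work] -/
theorem claw_cells {ω : BondConfig V} (hω : ω ⊆ ↑D) :
    (b ∈ cl ω.toFinset a ↔ (s(v, a) ∈ ω ∧ s(v, b) ∈ ω)) ∧ (c ∈ cl ω.toFinset a ↔ (s(v, a) ∈ ω ∧ s(v, c) ∈ ω)) ∧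
      (c ∈ cl ω.toFinset b ↔ (s(v, b) ∈ ω ∧ s(v, c) ∈ ω)) ∧ (Sep D (cl ω.toFinset a) b c ↔ s(v, a) ∈ ω) := by
  have hPa : ∀ e ∈ D, a ∈ e → e = s(v, a) := fun e he => (claw_pairs hab hac hbc hva hvb hvc hD he).1
  have hPb : ∀ e ∈ D, b ∈ e → e = s(v, b) := fun e he => (claw_pairs hab hac hbc hva hvb hvc hD he).2.1
  have hPc : ∀ e ∈ D, c ∈ e → e = s(v, c) := fun e he => (claw_pairs hab hac hbc hva hvb hvc hD he).2.2
  refine ⟨⟨fun h => claw_mem_cl hω hab h hPa hPb, fun h => claw_reach h.1 h.2 hva hvb⟩,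
    ⟨fun h => claw_mem_cl hω hac h hPa hPc, fun h => claw_reach h.1 h.2 hva hvc⟩,
    ⟨fun h => claw_mem_cl hω hbc h hPb hPc, fun h => claw_reach h.1 h.2 hvb hvc⟩, ⟨fun h => ?_, fun h => ?_⟩⟩
  · -- if `e₁` were closed, `C(a) = {a}` and `b v c` would avoid it
    by_contra h1
    have hnot : ∀ x ∈ cl ω.toFinset a, x = a := by
      intro x hx
      by_contra hxa
      obtain ⟨e, he, hae⟩ := APL.exists_mem_edge_of_mem_cl (mem_cl_comm.1 hx) (Ne.symm hxa)
      rw [mem_toFinset'] at he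
      exact h1 (hPa e (hω he) hae ▸ he)
    have h2 : s(v, b) ∈ D \ touch (cl ω.toFinset a) := by
      rw [Finset.mem_sdiff, mk_mem_touch, not_or]
      exact ⟨(hD _).2 (Or.inr (Or.inl rfl)), fun h' => hva (hnot v h'), fun h' => hab.symm (hnot b h')⟩
    have h3 : s(v, c) ∈ D \ touch (cl ω.toFinset a) := by
      rw [Finset.mem_sdiff, mk_mem_touch, not_or]
      exact ⟨(hD _).2 (Or.inr (Or.inr rfl)), fun h' => hva (hnot v h'), fun h' => hac.symm (hnot c h')⟩
    refine h (mem_cl.2 ?_)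
    have e1 : (openGraph (↑(D \ touch (cl ω.toFinset a)) : Set (Sym2 V))).Adj b v := by
      rw [openGraph_adj, Finset.mem_coe, Sym2.eq_swap]; exact ⟨h2, hvb.symm⟩
    have e2 : (openGraph (↑(D \ touch (cl ω.toFinset a)) : Set (Sym2 V))).Adj v c := by
      rw [openGraph_adj, Finset.mem_coe]; exact ⟨h3, hvc⟩
    exact e1.reachable.trans e2.reachable
  · -- if `e₁` is open, every support pair touches `v ∈ C(a)`
    have hv : v ∈ cl ω.toFinset a := by
      rw [mem_cl, Set.coe_toFinset]
      refine Adj.reachable ?_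
      rw [openGraph_adj, Sym2.eq_swap]; exact ⟨h, hva.symm⟩
    intro h'
    obtain ⟨e, he, hce⟩ := APL.exists_mem_edge_of_mem_cl h' hbc.symm
    rw [Finset.mem_sdiff, mem_touch] at he
    refine he.2 ⟨v, hv, ?_⟩
    rcases (hD e).1 he.1 with rfl | rfl | rfl <;> exact Sym2.mem_mk_left _ _

end Claw

/-! ### Swapping one coordinate between two configurations -/

section Swap

variable (u : Sym2 V → unitInterval) {q : ℝ} (hq : 0 ≤ q)
include hq

/-- **Exchange of one coordinate block between two independent copies dominates a product of masses.**  Let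
`σ(ω, ω') = (t.ite ω' ω, t.ite ω ω')` exchange the `t`-coordinates.  If every pair `(ω, ω') ∈ E₁ × E₂` of
positive weight is sent into `F₁ × F₂` with the same product of random-cluster weights, then
`M(E₁)·M(E₂) ≤ M(F₁)·M(F₂)` for the unnormalised masses `M(E) = Σ rcWeightW · 1_E`. [this work] -/
theorem mass_mul_le_of_swap (t : Set (Sym2 V)) (E₁ E₂ F₁ F₂ : Set (BondConfig V))
    (h : ∀ ω ω' : BondConfig V, ω ∈ E₁ → ω' ∈ E₂ → rcWeightW u q ∅ ω * rcWeightW u q ∅ ω' ≠ 0 →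
      (t.ite ω' ω ∈ F₁ ∧ t.ite ω ω' ∈ F₂ ∧
        rcWeightW u q ∅ ω * rcWeightW u q ∅ ω' = rcWeightW u q ∅ (t.ite ω' ω) * rcWeightW u q ∅ (t.ite ω ω'))) :
    (∑ η : BondConfig V, rcWeightW u q ∅ η * ind E₁ η) * (∑ η : BondConfig V, rcWeightW u q ∅ η * ind E₂ η) ≤
      (∑ η : BondConfig V, rcWeightW u q ∅ η * ind F₁ η) * (∑ η : BondConfig V, rcWeightW u q ∅ η * ind F₂ η) := by
  rw [Finset.sum_mul_sum, Finset.sum_mul_sum, ← Finset.sum_product', ← Finset.sum_product', Finset.univ_product_univ]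
  set σ : BondConfig V × BondConfig V → BondConfig V × BondConfig V := fun p => (t.ite p.2 p.1, t.ite p.1 p.2) with hσ
  have hbij : Function.Bijective σ := (swap_involutive t).bijective
  have hnn : ∀ (η : BondConfig V) (E : Set (BondConfig V)), 0 ≤ rcWeightW u q ∅ η * ind E η := fun η E =>
    mul_nonneg (rcWeightW_nonneg u hq ∅ η) (ind_nonneg E η)
  calc ∑ p : BondConfig V × BondConfig V, rcWeightW u q ∅ p.1 * ind E₁ p.1 * (rcWeightW u q ∅ p.2 * ind E₂ p.2)
      ≤ ∑ p : BondConfig V × BondConfig V,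
          rcWeightW u q ∅ (σ p).1 * ind F₁ (σ p).1 * (rcWeightW u q ∅ (σ p).2 * ind F₂ (σ p).2) := by
        refine Finset.sum_le_sum fun p _ => ?_
        by_cases hp : p.1 ∈ E₁ ∧ p.2 ∈ E₂ ∧ rcWeightW u q ∅ p.1 * rcWeightW u q ∅ p.2 ≠ 0
        · obtain ⟨h1, h2, h3⟩ := h p.1 p.2 hp.1 hp.2.1 hp.2.2
          rw [ind_of_mem hp.1, ind_of_mem hp.2.1, ind_of_mem h1, ind_of_mem h2]
          simp only [hσ, mul_one]
          exact h3.le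
        · have h0 : rcWeightW u q ∅ p.1 * ind E₁ p.1 * (rcWeightW u q ∅ p.2 * ind E₂ p.2) = 0 := by
            by_cases h1 : p.1 ∈ E₁
            · by_cases h2 : p.2 ∈ E₂
              · have h3 : rcWeightW u q ∅ p.1 * rcWeightW u q ∅ p.2 = 0 := by
                  by_contra h3; exact hp ⟨h1, h2, h3⟩
                rw [ind_of_mem h1, ind_of_mem h2, mul_one, mul_one, h3]
              · rw [ind_of_not_mem h2]; ring
            · rw [ind_of_not_mem h1]; ring
          rw [h0]
          exact mul_nonneg (hnn _ _) (hnn _ _)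
    _ = ∑ p : BondConfig V × BondConfig V, rcWeightW u q ∅ p.1 * ind F₁ p.1 * (rcWeightW u q ∅ p.2 * ind F₂ p.2) :=
        Fintype.sum_bijective σ hbij _ _ fun p => rfl

omit [Fintype V] hq in
/-- Membership in the exchanged configuration. [folklore] -/
theorem mem_ite_singleton {e x : Sym2 V} {s s' : Set (Sym2 V)} :
    x ∈ ({e} : Set (Sym2 V)).ite s s' ↔ ((x = e ∧ x ∈ s) ∨ (x ≠ e ∧ x ∈ s')) := by
  simp only [Set.ite, Set.mem_union, Set.mem_inter_iff, Set.mem_sdiff, Set.mem_singleton_iff]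
  tauto

omit hq in
/-- **Opening a pair towards an isolated vertex lowers the cluster count by one.** [folklore] -/
theorem clusterCount_insert_isolated {ξ : BondConfig V} {x y : V} (hxy : x ≠ y) (hy : ∀ e ∈ ξ, y ∉ e) :
    clusterCount (insert s(x, y) ξ) ∅ + 1 = clusterCount ξ ∅ := by
  have h := card_cc_sup_edge (openGraph ξ) x y
  have hr : ¬ (openGraph ξ).Reachable x y := fun hr => by
    obtain ⟨w, hw⟩ := TerminalGluing.exists_adj_of_reachable_ne hr.symm hxy.symm
    rw [openGraph_adj] at hw
    exact hy _ hw.1 (Sym2.mem_mk_left y w)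
  rw [if_neg hr] at h
  unfold clusterCount
  rw [wired_empty, sup_bot_eq, sup_bot_eq, openGraph_insert]
  exact h

omit hq in
/-- A configuration of nonzero weight lies inside the support. [folklore] -/
theorem subset_of_rcWeightW_ne_zero {D : Set (Sym2 V)} (hu : ∀ e, e ∉ D → (u e : ℝ) = 0) {ω : BondConfig V}
    (h : rcWeightW u q ∅ ω ≠ 0) : ω ⊆ D := by
  by_contra hω
  apply h
  unfold rcWeightW; rw [weight_eq_zero_of_not_subset u hu hω, zero_mul]

end Swap

/-! ### The three rows for the claw -/

section ClawSwap

/-- **The exchange step for the claw.**  For configurations `ω, ω'` inside the support with the pair `e = s(v,y)`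
(`y ∈ {b, c}` a leaf: its only support pair is `e`) open in exactly one of them, exchanging the `e`-coordinate
preserves the product of the two random-cluster weights. [this work] -/
theorem claw_swap_weight (u : Sym2 V → unitInterval) (q : ℝ) {D : Finset (Sym2 V)} {v y : V} (hvy : v ≠ y) (hy : ∀ e ∈ D, y ∈ e → e = s(v, y)) {ω ω' : BondConfig V}
    (hω : ω ⊆ ↑D) (hω' : ω' ⊆ ↑D) (he : s(v, y) ∈ ω) (he' : s(v, y) ∉ ω') :
    rcWeightW u q ∅ ω * rcWeightW u q ∅ ω' =
      rcWeightW u q ∅ (({s(v, y)} : Set (Sym2 V)).ite ω' ω) * rcWeightW u q ∅ (({s(v, y)} : Set (Sym2 V)).ite ω ω') := by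
  -- the exchanged configurations are `ω ∖ e` and `ω' ∪ e`
  have e1 : ({s(v, y)} : Set (Sym2 V)).ite ω' ω = ω \ {s(v, y)} := by
    ext x; rw [mem_ite_singleton, Set.mem_sdiff, Set.mem_singleton_iff]
    constructor
    · rintro (⟨rfl, hx⟩ | ⟨hx, hx'⟩)
      · exact absurd hx he'
      · exact ⟨hx', hx⟩
    · rintro ⟨hx, hx'⟩; exact Or.inr ⟨hx', hx⟩
  have e2 : ({s(v, y)} : Set (Sym2 V)).ite ω ω' = insert s(v, y) ω' := by
    ext x; rw [mem_ite_singleton, Set.mem_insert_iff]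
    constructor
    · rintro (⟨rfl, _⟩ | ⟨_, hx'⟩)
      · exact Or.inl rfl
      · exact Or.inr hx'
    · rintro (rfl | hx)
      · exact Or.inl ⟨rfl, he⟩
      · by_cases hxe : x = s(v, y)
        · exact Or.inl ⟨hxe, hxe ▸ he⟩
        · exact Or.inr ⟨hxe, hx⟩
  rw [e1, e2]
  -- product part
  have hw := weight_swap (fun e => (u e : ℝ)) ({s(v, y)} : Set (Sym2 V)) ω ω'
  rw [e2, e1] at hw
  -- cluster part: `y` is isolated in `ω ∖ e` and in `ω'`
  have hiso : ∀ e ∈ ω \ {s(v, y)}, y ∉ e := fun e he hye =>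
    he.2 (hy e (hω he.1) hye)
  have hiso' : ∀ e ∈ ω', y ∉ e := fun e he hye => he' (hy e (hω' he) hye ▸ he)
  have hk1 := clusterCount_insert_isolated (ξ := ω \ {s(v, y)}) hvy hiso
  rw [Set.insert_sdiff_singleton, Set.insert_eq_of_mem he] at hk1
  have hk2 := clusterCount_insert_isolated (ξ := ω') hvy hiso'
  unfold rcWeightW
  have hpow : q ^ clusterCount ω ∅ * q ^ clusterCount ω' ∅ =
      q ^ clusterCount (ω \ {s(v, y)}) ∅ * q ^ clusterCount (insert s(v, y) ω') ∅ := by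
    rw [← pow_add, ← pow_add]; congr 1; omega
  calc weight (fun e => (u e : ℝ)) ω * q ^ clusterCount ω ∅ * (weight (fun e => (u e : ℝ)) ω' * q ^ clusterCount ω' ∅)
      = (weight (fun e => (u e : ℝ)) ω * weight (fun e => (u e : ℝ)) ω') *
          (q ^ clusterCount ω ∅ * q ^ clusterCount ω' ∅) := by ring
    _ = (weight (fun e => (u e : ℝ)) (insert s(v, y) ω') * weight (fun e => (u e : ℝ)) (ω \ {s(v, y)})) *
          (q ^ clusterCount (ω \ {s(v, y)}) ∅ * q ^ clusterCount (insert s(v, y) ω') ∅) := by rw [hw, hpow]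
    _ = _ := by ring

omit [Fintype V] in
/-- The exchanged configurations stay inside the support. [folklore] -/
theorem ite_subset {D : Set (Sym2 V)} {t ω ω' : BondConfig V} (hω : ω ⊆ D) (hω' : ω' ⊆ D) : t.ite ω' ω ⊆ D :=
  fun x hx => by
  simp only [Set.ite, Set.mem_union, Set.mem_inter_iff, Set.mem_sdiff] at hx
  rcases hx with ⟨hx, _⟩ | ⟨hx, _⟩
  exacts [hω' hx, hω hx]

end ClawSwap

section ClawRows

variable {a b c v : V} {D : Finset (Sym2 V)} (hab : a ≠ b) (hac : a ≠ c) (hbc : b ≠ c)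
include hab hac hbc

omit [Fintype V] in
/-- The three pairs of the claw are distinct. [folklore] -/
theorem claw_ne : s(v, a) ≠ s(v, b) ∧ s(v, a) ≠ s(v, c) ∧ s(v, b) ≠ s(v, c) := by
  refine ⟨fun h => ?_, fun h => ?_, fun h => ?_⟩ <;> rw [Sym2.eq_iff] at h <;>
    rcases h with ⟨_, h⟩ | ⟨h, _⟩ <;> simp_all

variable (hva : v ≠ a) (hvb : v ≠ b) (hvc : v ≠ c)
  (hD : ∀ e, e ∈ D ↔ (e = s(v, a) ∨ e = s(v, b) ∨ e = s(v, c)))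
  (u : Sym2 V → unitInterval) {q : ℝ} (hq : 0 < q) (hu : ∀ e, e ∉ (↑D : Set (Sym2 V)) → (u e : ℝ) = 0)
include hva hvb hvc hD hq hu

omit hq hu in
/-- Inside the support: the coordinates of a configuration of a cell (read off `claw_cells`). [this work] -/
theorem claw_coords {ω : BondConfig V} (hω : ω ⊆ ↑D) :
    (ω ∈ {η : BondConfig V | b ∈ cl η.toFinset a ∧ c ∈ cl η.toFinset a} → (s(v, a) ∈ ω ∧ s(v, b) ∈ ω ∧ s(v, c) ∈ ω)) ∧
    (ω ∈ {η : BondConfig V | b ∉ cl η.toFinset a ∧ c ∉ cl η.toFinset a ∧ Sep D (cl η.toFinset a) b c} → (s(v, a) ∈ ω ∧ s(v, b) ∉ ω ∧ s(v, c) ∉ ω)) ∧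
    (ω ∈ {η : BondConfig V | b ∉ cl η.toFinset a ∧ c ∉ cl η.toFinset a ∧ c ∈ cl η.toFinset b} → (s(v, a) ∉ ω ∧ s(v, b) ∈ ω ∧ s(v, c) ∈ ω)) := by
  obtain ⟨cb, cc, ccb, cs⟩ := claw_cells hab hac hbc hva hvb hvc hD hω
  refine ⟨fun h => ⟨(cb.1 h.1).1, (cb.1 h.1).2, (cc.1 h.2).2⟩, fun h => ?_, fun h => ?_⟩
  · have h1 : s(v, a) ∈ ω := cs.1 h.2.2
    exact ⟨h1, fun h' => h.1 (cb.2 ⟨h1, h'⟩), fun h' => h.2.1 (cc.2 ⟨h1, h'⟩)⟩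
  · obtain ⟨h2, h3⟩ := ccb.1 h.2.2
    exact ⟨fun h' => h.1 (cb.2 ⟨h', h2⟩), h2, h3⟩

omit hq hu in
/-- Inside the support: membership in a cell from the coordinates (read off `claw_cells`). [this work] -/
theorem claw_of_coords {ω : BondConfig V} (hω : ω ⊆ ↑D) :
    ((s(v, a) ∈ ω ∧ s(v, b) ∈ ω ∧ s(v, c) ∉ ω) → ω ∈ {η : BondConfig V | b ∈ cl η.toFinset a ∧ c ∉ cl η.toFinset a}) ∧
    ((s(v, a) ∈ ω ∧ s(v, b) ∉ ω ∧ s(v, c) ∈ ω) → ω ∈ {η : BondConfig V | b ∉ cl η.toFinset a ∧ c ∈ cl η.toFinset a}) ∧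
    ((s(v, a) ∉ ω ∧ s(v, b) ∉ ω) → ω ∈ {η : BondConfig V | b ∉ cl η.toFinset a ∧ c ∉ cl η.toFinset a ∧ c ∉ cl η.toFinset b ∧ ¬ Sep D (cl η.toFinset a) b c}) ∧
    ((s(v, a) ∉ ω ∧ s(v, c) ∉ ω) → ω ∈ {η : BondConfig V | b ∉ cl η.toFinset a ∧ c ∉ cl η.toFinset a ∧ c ∉ cl η.toFinset b ∧ ¬ Sep D (cl η.toFinset a) b c}) := by
  obtain ⟨cb, cc, ccb, cs⟩ := claw_cells hab hac hbc hva hvb hvc hD hω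
  refine ⟨fun h => ⟨cb.2 ⟨h.1, h.2.1⟩, fun h' => h.2.2 (cc.1 h').2⟩,
    fun h => ⟨fun h' => h.2.1 (cb.1 h').2, cc.2 ⟨h.1, h.2.2⟩⟩,
    fun h => ⟨fun h' => h.1 (cb.1 h').1, fun h' => h.1 (cc.1 h').1, fun h' => h.2 (ccb.1 h').1,
      fun h' => h.1 (cs.1 h')⟩,
    fun h => ⟨fun h' => h.1 (cb.1 h').1, fun h' => h.1 (cc.1 h').1, fun h' => h.2 (ccb.1 h').2,
      fun h' => h.1 (cs.1 h')⟩⟩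

/-- **R1 for the claw**: `φ(T)·φ(S) ≤ φ(U_b)·φ(U_c)` (exchange the `e₃`-coordinate). [this work] -/
theorem claw_r1 : (rcMeasureW u q ∅).real {η : BondConfig V | b ∈ cl η.toFinset a ∧ c ∈ cl η.toFinset a} * (rcMeasureW u q ∅).real {η : BondConfig V | b ∉ cl η.toFinset a ∧ c ∉ cl η.toFinset a ∧ Sep D (cl η.toFinset a) b c} ≤ (rcMeasureW u q ∅).real {η : BondConfig V | b ∈ cl η.toFinset a ∧ c ∉ cl η.toFinset a} * (rcMeasureW u q ∅).real {η : BondConfig V | b ∉ cl η.toFinset a ∧ c ∈ cl η.toFinset a} := by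
  obtain ⟨n12, n13, n23⟩ := claw_ne (v := v) hab hac hbc
  have hPc : ∀ e ∈ D, c ∈ e → e = s(v, c) := fun e he => (claw_pairs hab hac hbc hva hvb hvc hD he).2.2
  have hZ := rcPartitionFunctionW_pos u hq (∅ : Set V)
  simp only [rcMeasureW_real_eq_sum_div u hq]
  rw [div_mul_div_comm, div_mul_div_comm]
  refine div_le_div_of_nonneg_right ?_ (mul_pos hZ hZ).le
  refine mass_mul_le_of_swap u hq.le ({s(v, c)} : Set (Sym2 V)) _ _ _ _ fun ω ω' hω1 hω2 hne => ?_
  have hω : ω ⊆ ↑D := subset_of_rcWeightW_ne_zero u hu (left_ne_zero_of_mul hne)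
  have hω' : ω' ⊆ ↑D := subset_of_rcWeightW_ne_zero u hu (right_ne_zero_of_mul hne)
  obtain ⟨h1, h2, h3⟩ := (claw_coords hab hac hbc hva hvb hvc hD hω).1 hω1
  obtain ⟨h1', h2', h3'⟩ := (claw_coords hab hac hbc hva hvb hvc hD hω').2.1 hω2
  refine ⟨(claw_of_coords hab hac hbc hva hvb hvc hD (ite_subset hω hω')).1
      ⟨?_, ?_, ?_⟩,
    (claw_of_coords hab hac hbc hva hvb hvc hD (ite_subset hω' hω)).2.1
      ⟨?_, ?_, ?_⟩,
    claw_swap_weight u q hvc hPc hω hω' h3 h3'⟩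
  · exact mem_ite_singleton.2 (Or.inr ⟨n13, h1⟩)
  · exact mem_ite_singleton.2 (Or.inr ⟨n23, h2⟩)
  · exact fun h => by rcases mem_ite_singleton.1 h with ⟨_, h⟩ | ⟨h, _⟩; exacts [h3' h, h rfl]
  · exact mem_ite_singleton.2 (Or.inr ⟨n13, h1'⟩)
  · exact fun h => by rcases mem_ite_singleton.1 h with ⟨h, _⟩ | ⟨_, h⟩; exacts [n23 h, h2' h]
  · exact mem_ite_singleton.2 (Or.inl ⟨rfl, h3⟩)

/-- **LB for the claw**: `φ(S)·φ(U_a) ≤ φ(N)·φ(U_b)` (exchange the `e₂`-coordinate). [this work] -/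
theorem claw_lb : (rcMeasureW u q ∅).real {η : BondConfig V | b ∉ cl η.toFinset a ∧ c ∉ cl η.toFinset a ∧ Sep D (cl η.toFinset a) b c} * (rcMeasureW u q ∅).real {η : BondConfig V | b ∉ cl η.toFinset a ∧ c ∉ cl η.toFinset a ∧ c ∈ cl η.toFinset b} ≤ (rcMeasureW u q ∅).real {η : BondConfig V | b ∉ cl η.toFinset a ∧ c ∉ cl η.toFinset a ∧ c ∉ cl η.toFinset b ∧ ¬ Sep D (cl η.toFinset a) b c} * (rcMeasureW u q ∅).real {η : BondConfig V | b ∈ cl η.toFinset a ∧ c ∉ cl η.toFinset a} := by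
  obtain ⟨n12, n13, n23⟩ := claw_ne (v := v) hab hac hbc
  have hPb : ∀ e ∈ D, b ∈ e → e = s(v, b) := fun e he => (claw_pairs hab hac hbc hva hvb hvc hD he).2.1
  have hZ := rcPartitionFunctionW_pos u hq (∅ : Set V)
  simp only [rcMeasureW_real_eq_sum_div u hq]
  rw [div_mul_div_comm, div_mul_div_comm, mul_comm (∑ η : BondConfig V, rcWeightW u q ∅ η * ind {η : BondConfig V | b ∉ cl η.toFinset a ∧ c ∉ cl η.toFinset a ∧ c ∉ cl η.toFinset b ∧ ¬ Sep D (cl η.toFinset a) b c} η)]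
  refine div_le_div_of_nonneg_right ?_ (mul_pos hZ hZ).le
  -- pairs (ω', ω) ∈ U_a × S ↦ exchange e₂: (ω' ∖ e₂, ω ∪ e₂) ∈ N × U_b; we run the swap lemma on (S, U_a)
  rw [mul_comm]
  refine le_trans ?_ (le_of_eq (mul_comm _ _))
  refine mass_mul_le_of_swap u hq.le ({s(v, b)} : Set (Sym2 V)) _ _ _ _ fun ω' ω hω2 hω1 hne => ?_
  have hω' : ω' ⊆ ↑D := subset_of_rcWeightW_ne_zero u hu (left_ne_zero_of_mul hne)
  have hω : ω ⊆ ↑D := subset_of_rcWeightW_ne_zero u hu (right_ne_zero_of_mul hne)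
  obtain ⟨h1', h2', h3'⟩ := (claw_coords hab hac hbc hva hvb hvc hD hω').2.2 hω2
  obtain ⟨h1, h2, h3⟩ := (claw_coords hab hac hbc hva hvb hvc hD hω).2.1 hω1
  refine ⟨(claw_of_coords hab hac hbc hva hvb hvc hD (ite_subset hω' hω)).2.2.1
      ⟨?_, ?_⟩,
    (claw_of_coords hab hac hbc hva hvb hvc hD (ite_subset hω hω')).1
      ⟨?_, ?_, ?_⟩,
    claw_swap_weight u q hvb hPb hω' hω h2' h2⟩
  · exact fun h => by rcases mem_ite_singleton.1 h with ⟨h, _⟩ | ⟨_, h⟩; exacts [n12 h, h1' h]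
  · exact fun h => by rcases mem_ite_singleton.1 h with ⟨_, h⟩ | ⟨h, _⟩; exacts [h2 h, h rfl]
  · exact mem_ite_singleton.2 (Or.inr ⟨n12, h1⟩)
  · exact mem_ite_singleton.2 (Or.inl ⟨rfl, h2'⟩)
  · exact fun h => by rcases mem_ite_singleton.1 h with ⟨h, _⟩ | ⟨_, h⟩; exacts [n23.symm h, h3 h]

/-- **LG for the claw**: `φ(S)·φ(U_a) ≤ φ(N)·φ(U_c)` (exchange the `e₃`-coordinate). [this work] -/
theorem claw_lg : (rcMeasureW u q ∅).real {η : BondConfig V | b ∉ cl η.toFinset a ∧ c ∉ cl η.toFinset a ∧ Sep D (cl η.toFinset a) b c} * (rcMeasureW u q ∅).real {η : BondConfig V | b ∉ cl η.toFinset a ∧ c ∉ cl η.toFinset a ∧ c ∈ cl η.toFinset b} ≤ (rcMeasureW u q ∅).real {η : BondConfig V | b ∉ cl η.toFinset a ∧ c ∉ cl η.toFinset a ∧ c ∉ cl η.toFinset b ∧ ¬ Sep D (cl η.toFinset a) b c} * (rcMeasureW u q ∅).real {η : BondConfig V | b ∉ cl η.toFinset a ∧ c ∈ cl η.toFinset a}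 := by
  obtain ⟨n12, n13, n23⟩ := claw_ne (v := v) hab hac hbc
  have hPc : ∀ e ∈ D, c ∈ e → e = s(v, c) := fun e he => (claw_pairs hab hac hbc hva hvb hvc hD he).2.2
  have hZ := rcPartitionFunctionW_pos u hq (∅ : Set V)
  simp only [rcMeasureW_real_eq_sum_div u hq]
  rw [div_mul_div_comm, div_mul_div_comm, mul_comm (∑ η : BondConfig V, rcWeightW u q ∅ η * ind {η : BondConfig V | b ∉ cl η.toFinset a ∧ c ∉ cl η.toFinset a ∧ c ∉ cl η.toFinset b ∧ ¬ Sep D (cl η.toFinset a) b c} η)]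
  refine div_le_div_of_nonneg_right ?_ (mul_pos hZ hZ).le
  rw [mul_comm]
  refine le_trans ?_ (le_of_eq (mul_comm _ _))
  refine mass_mul_le_of_swap u hq.le ({s(v, c)} : Set (Sym2 V)) _ _ _ _ fun ω' ω hω2 hω1 hne => ?_
  have hω' : ω' ⊆ ↑D := subset_of_rcWeightW_ne_zero u hu (left_ne_zero_of_mul hne)
  have hω : ω ⊆ ↑D := subset_of_rcWeightW_ne_zero u hu (right_ne_zero_of_mul hne)
  obtain ⟨h1', h2', h3'⟩ := (claw_coords hab hac hbc hva hvb hvc hD hω').2.2 hω2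
  obtain ⟨h1, h2, h3⟩ := (claw_coords hab hac hbc hva hvb hvc hD hω).2.1 hω1
  refine ⟨(claw_of_coords hab hac hbc hva hvb hvc hD (ite_subset hω' hω)).2.2.2
      ⟨?_, ?_⟩,
    (claw_of_coords hab hac hbc hva hvb hvc hD (ite_subset hω hω')).2.1
      ⟨?_, ?_, ?_⟩,
    claw_swap_weight u q hvc hPc hω' hω h3' h3⟩
  · exact fun h => by rcases mem_ite_singleton.1 h with ⟨h, _⟩ | ⟨_, h⟩; exacts [n13 h, h1' h]
  · exact fun h => by rcases mem_ite_singleton.1 h with ⟨_, h⟩ | ⟨h, _⟩; exacts [h3 h, h rfl]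
  · exact mem_ite_singleton.2 (Or.inr ⟨n13, h1⟩)
  · exact fun h => by rcases mem_ite_singleton.1 h with ⟨h, _⟩ | ⟨_, h⟩; exacts [n23 h, h2 h]
  · exact mem_ite_singleton.2 (Or.inl ⟨rfl, h3'⟩)

end ClawRows

end ThreeSum

end Summit.CriticalPhenomena.PercolationContinuityZ3.Theorems
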